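import Summits.NavierStokesRegularity.NavierStokesRegularity.Theses.DulacContraction
import HarnessLib.Audit

/-!
# Birth skeleton (BC3) of the crux `DulacContraction.SynchronizationModSimilarity` (K1)

(crux item `stmt-NavierStokesRegularity-8559`, rank 2, route
`route-NavierStokesRegularity-DulacContraction`; tree path
`Cruxes/SynchronizationModSimilarity/Lines/birth.lean`; registrar
`planner-skel-stmt-NavierStokesRegularity-8559-0`, 2026-08-17. The route predates the Lean birth
certificate; this file supplies BC3 retroactively. At registration the crux had NO workfiles
(`ledger crux ls`: no `Disproof.lean`, no ideas, no earlier lines), so there is no disprover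
obligation to honour yet.)

THE CRUX (fixed; the route's decl, K1 "synchronisation modulo similarity in the Type-I class").
Phase space: the smooth Albritton–Barker Type-I class `𝒦_C` on the slab `ℝ³ × (−∞,0)` — `(u,p,G)`
suitable weak (ν = 1, f = 0), weak gradient `G`, `typeIBound < ⊤`, rate `|u| ≤ C/√(−t)`
(`HasTypeITimeDecay C`), classical on `(−∞,0)`. Profiles at log-scale `σ`:
`Π_σ w (y) = e^σ w(−e^{2σ}, e^σ y)`; weighted energy `E(f) = ∫ |f|² (1+|y|²)⁻²`; similarity action
`(g·u)(t,x) = l Rᵀ u(l²t+τ, lRx+ξ)`, `g = (l>0, R ∈ O(3), ξ, τ ≤ 0)`. K1: for every `C` there are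
`η > 0, c ≥ 0, δ > 0` such that for all pairs `u, w ∈ 𝒦_C`, every `σ₀` and every `g₀`:
`E(Π_σ₀ w − Π_σ₀(g₀·u)) ≤ δ ⇒ ∃ g, ∀ σ ≤ σ₀, E(Π_σ w − Π_σ(g·u)) ≤ c e^{−η(σ₀−σ)} δ`.

Below, `prof`, `Ew`, `act` are K1's three inlined `let`s as transparent definitions and
`gap u w σ l R ξ τ` is the synchronisation gap `E(Π_σ w − Π_σ(g·u))`, `g = (l,R,ξ,τ)`; every stub
carries K1's five class hypotheses on each profile verbatim; `sync_iff` records that K1 is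
DEFINITIONALLY the statement over these abbreviations (`Iff.rfl`), so nothing is restated.

THE CUT — the classical anatomy of "orbital exponential stability with asymptotic phase"
(Hale, ODEs, Ch. VI §2; Muldowney 1990 Thm 4.2 via the second compound; Li–Muldowney 1995/96),
transplanted to the Leray-rescaled flow modulo the similarity group `G⁺`, with the semigroup
bookkeeping done HERE and the three genuinely different analytic inputs named:

* `stub_finiteWindowStability` [M/L; continuous dependence] — for every `C` and every window
  length `s > 0` there are `δ₂ > 0, c₀ ≥ 0` such that `gap_{σ₀}(g₀) ≤ δ ≤ δ₂` implies
  `gap_σ(g₀) ≤ c₀ δ` for all `σ ∈ [σ₀ − s, σ₀]` — the SAME comparison element `g₀`, finite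
  log-time, linear in `δ`: Lipschitz continuous dependence of the profile (Leray) flow over a finite
  log-time window in the scale-covariant weighted norm `E`, uniformly on `𝒦_C` (both `w` and `g₀·u`
  are Navier–Stokes solutions with the Type-I bound `C`, since `G⁺` consists of symmetries of NS
  preserving the rate). Why it might fail: the weight `(1+|y|²)⁻²` is NOT an `A₂` weight on `ℝ³`
  (Riesz transforms are unbounded on `L²((1+|y|²)⁻² dy)`), so the far field of the difference —
  size `O(C)`, invisible to `E` — feeds the near-field pressure gradient; the route's own weight
  window `3 < m ≤ 5` (NUMBERS) is the bet that this leakage is dominated; and the constants must be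
  uniform in `C` although `C` does not bound `𝐈 = typeIBound` (arXiv:1811.00502 Rem. 3.2; the
  refuter's K1M objection lives already here).
* `stub_windowContraction` [XL; OPEN — the load-bearing bet, the contraction certificate proper] —
  for every `C` there are `δ₁ > 0` and ONE window length `s > 0` such that `gap_{σ₀}(g₀) ≤ δ ≤ δ₁`
  implies `gap_{σ₀−s}(g₁) ≤ δ/e` for SOME `g₁ ∈ G⁺` (re-phasing allowed: the neutral / unstable
  similarity modes — exponents `1, ½,½,½, 0,0,0` and the flow direction — are absorbed into `g₁`,
  the transversal rest contracts). Phase-free, finite log-time, linear gain: exactly what a matrix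
  Dulac function / Lozinskii bound for the second additive compound of the linearised profile
  operator modulo the 7 similarity modes, integrated over one window, would deliver (Muldowney1990,
  LiMuldowney1996, KuznetsovReitmann2021 Ch. 5) — the route's foreseen layer-2 child
  `LinearAreaContraction → LinearToNonlinearSync` lives inside this stub. The factor `e⁻¹` at SOME
  `s` is no hand-picked threshold: any `θ < 1` over a window `s_θ` gives `e⁻¹` over `⌈1/log θ⁻¹⌉ s_θ`
  because the statement composes (it re-chooses `g`). Why it might fail: = why K1 might fail — one
  saddle-type (R)DSS profile, an invariant torus or a chaotic tangent flow in `𝒦_C ≠ {0}` refutes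
  it; at `u = 0` it is one-slice weighted-`L²` ε-regularity WITH GAIN for Type-I local-energy
  solutions (JiaSverak2014 Thm 3.1, BarkerPrange2020 Thm 2 give `δ(C,M)`, not `δ(C)`).
* `stub_asymptoticPhase` [L; OPEN in this infinite-dimensional, non-compact-group setting] — for
  every `C, η > 0, c ≥ 0` there are `η' > 0, c' ≥ 0, δ₃ > 0` such that SCALE-WISE exponential
  closeness of `w` to the `G⁺`-orbit of `u` below `σ₀` (`∀ σ ≤ σ₀ ∃ g_σ, gap_σ(g_σ) ≤ c e^{−η(σ₀−σ)} δ`,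
  `δ ≤ δ₃`) forces exponential closeness to ONE orbit element (`∃ g ∀ σ ≤ σ₀,
  gap_σ(g) ≤ c' e^{−η'(σ₀−σ)} δ`) — the asymptotic phase: summability of the phase increments
  (LiMuldowney1995 / Smith1986 "autonomous convergence", Hale Ch. VI Thm 2.1) for the action of the
  NON-compact `G⁺` on `𝒦_C`, where the orbit closure contains `0` (`τ → −∞` pushes `g·u → 0` in `E`,
  refuter note rreview-0815T13) — so the lemma must cope with near-degenerate orbits; a rate loss
  `η' ≤ η` is allowed on purpose. Why it might fail: a profile `u` with approximate self-similarities
  at some scales but not others lets the near-optimal `g_σ` jump between far-apart group elements;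
  one `g` then needs same-`g` propagation of closeness (stability) plus a transversality modulus of
  the orbit map, neither uniform on `𝒦_C` a priori.

`SynchronizationModSimilarity_of : SynchronizationModSimilarity` (the ONLY theorem of this file
concluding the crux; conclusion = the crux BY NAME, no `Prop` hypotheses, `sorry` only inside the
three declared stubs, which it uses by name) is the real composition (≈ 70 lines): `δ := min δ₁ δ₂ δ₃`;
by induction on `k`, `stub_windowContraction` gives `g_k` with `gap_{σ₀−ks}(g_k) ≤ δ e^{−k}`; for
`σ ∈ [σ₀−(k+1)s, σ₀−ks]` (`k = ⌊(σ₀−σ)/s⌋₊`) `stub_finiteWindowStability` gives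
`gap_σ(g_k) ≤ c₀ δ e^{−k} ≤ (c₀e) e^{−(σ₀−σ)/s} δ`, i.e. scale-wise exponential closeness at rate
`η = 1/s`; `stub_asymptoticPhase` turns it into K1's single `g`. Its CLOSED twin
`SynchronizationModSimilarity_of_hyps : <sig 1> → <sig 2> → <sig 3> → SynchronizationModSimilarity`
(same proof, the stub statements as hypotheses, no placeholder anywhere) is the registrar's evidence
file `bc/SynchronizationModSimilarity_birth_closed.lean` attached to the crux item.

Disproof used: none exists for this crux. Negatives index: no refuted NS statement concerns
synchronisation / weighted profile distances (checked at registration). Degenerate-witness pass: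
the class is inhabited by the rest state `u = 0` (all three stubs hold there: `gap` is then
independent of `g`, S1/S2 reduce to the `u = 0` rung of K1, S3 is trivial with `η' = η, c' = c`);
`gap` is an `ℝ≥0∞`-valued `lintegral` (no junk value), thresholds are `ENNReal.ofReal` of reals
that the statements keep positive (`0 < δ`, `0 ≤ c₀, c, c'`).
-/

noncomputable section

open Set MeasureTheory Filter Topology
open scoped ENNReal NNReal

namespace Summit.NavierStokesRegularity.NavierStokesRegularity.Cruxes.SynchronizationModSimilarity.Birth

set_option linter.unusedVariables false
set_option linter.dupNamespace false

local notation "ℝ³" => EuclideanSpace ℝ (Fin 3)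

open Literature.Analysis.FluidPDE

/-- Profile of `w` at log-scale `σ`: `Π_σ w (y) = e^σ w(−e^{2σ}, e^σ y)` — K1's inlined `prof`. -/
def prof (σ : ℝ) (w : ℝ → ℝ³ → ℝ³) (y : ℝ³) : ℝ³ :=
  nsRescale (Real.exp σ) w (-1) y

/-- Weighted energy `E(f) = ∫ |f(y)|² (1+|y|²)⁻² dy` (in `ℝ≥0∞`) — K1's inlined `Ew`. -/
def Ew (f : ℝ³ → ℝ³) : ℝ≥0∞ :=
  ∫⁻ y, ‖f y‖ₑ ^ 2 * ENNReal.ofReal ((1 + ‖y‖ ^ 2)⁻¹ ^ 2)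

/-- The similarity action `(g·w)(t,x) = l Rᵀ w(l²t+τ, lRx+ξ)`, `g = (l, R, ξ, τ)` — K1's inlined `act`. -/
def act (l : ℝ) (R : ℝ³ ≃ₗᵢ[ℝ] ℝ³) (ξ : ℝ³) (τ : ℝ) (w : ℝ → ℝ³ → ℝ³) (t : ℝ) (x : ℝ³) : ℝ³ :=
  l • R.symm (w (l ^ 2 * t + τ) (l • R x + ξ))

/-- The synchronisation gap of `w` to `g·u` at log-scale `σ`: `E(Π_σ w − Π_σ(g·u))`, `g = (l, R, ξ, τ)`. -/
def gap (u w : ℝ → ℝ³ → ℝ³) (σ l : ℝ) (R : ℝ³ ≃ₗᵢ[ℝ] ℝ³) (ξ : ℝ³) (τ : ℝ) : ℝ≥0∞ :=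
  Ew (fun y => prof σ w y - prof σ (act l R ξ τ u) y)

/-- K1 over the local abbreviations — DEFINITIONALLY the route decl (proof `Iff.rfl`): nothing is restated. -/
theorem sync_iff :
    Theses.DulacContraction.SynchronizationModSimilarity ↔
    ∀ C : ℝ, ∃ η c δ : ℝ, 0 < η ∧ 0 ≤ c ∧ 0 < δ ∧
      ∀ (u : ℝ → ℝ³ → ℝ³) (p : ℝ → ℝ³ → ℝ) (G : ℝ → ℝ³ → ℝ³ →L[ℝ] ℝ³),
        IsSuitableWeakSolutionOn (slab ℝ³ (Set.Iio 0) isOpen_Iio) 1 0 u p →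
        HasWeakSpatialGradientOn (slab ℝ³ (Set.Iio 0) isOpen_Iio) u G →
        typeIBound (Set.Iio (0 : ℝ) ×ˢ Set.univ) u p G < ⊤ → HasTypeITimeDecay C u →
        IsClassicalNSSolutionOn (Set.Iio 0) 1 0 u p →
      ∀ (w : ℝ → ℝ³ → ℝ³) (q : ℝ → ℝ³ → ℝ) (H : ℝ → ℝ³ → ℝ³ →L[ℝ] ℝ³),
        IsSuitableWeakSolutionOn (slab ℝ³ (Set.Iio 0) isOpen_Iio) 1 0 w q →
        HasWeakSpatialGradientOn (slab ℝ³ (Set.Iio 0) isOpen_Iio) w H →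
        typeIBound (Set.Iio (0 : ℝ) ×ˢ Set.univ) w q H < ⊤ → HasTypeITimeDecay C w →
        IsClassicalNSSolutionOn (Set.Iio 0) 1 0 w q →
      ∀ (σ₀ l₀ : ℝ) (R₀ : ℝ³ ≃ₗᵢ[ℝ] ℝ³) (ξ₀ : ℝ³) (τ₀ : ℝ), 0 < l₀ → τ₀ ≤ 0 →
        gap u w σ₀ l₀ R₀ ξ₀ τ₀ ≤ ENNReal.ofReal δ →
        ∃ (l : ℝ) (R : ℝ³ ≃ₗᵢ[ℝ] ℝ³) (ξ : ℝ³) (τ : ℝ), 0 < l ∧ τ ≤ 0 ∧ ∀ σ : ℝ, σ ≤ σ₀ →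
          gap u w σ l R ξ τ ≤ ENNReal.ofReal (c * Real.exp (-(η * (σ₀ - σ))) * δ) :=
  Iff.rfl

/-- **stub 1 — `stub_finiteWindowStability` (M/L; Lipschitz continuous dependence of the Leray-rescaled
flow modulo similarity over a finite log-time window, in the scale-covariant weighted norm, uniformly on
`𝒦_C`).** For every rate `C` and window length `s > 0` there are `δ₂ > 0`, `c₀ ≥ 0` such that for all
smooth `𝒦_C` profiles `u, w`, every `0 < δ ≤ δ₂`, every log-scale `σ₀` and every comparison element
`g₀ = (l₀ > 0, R₀, ξ₀, τ₀ ≤ 0)`: `gap_{σ₀}(g₀) ≤ δ ⇒ gap_σ(g₀) ≤ c₀ δ` for all `σ ∈ [σ₀ − s, σ₀]`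
(the SAME `g₀`; finer scales = forward physical time, where NS is well posed). Where it is exposed:
the weight `(1+|y|²)⁻²` is not `A₂` (far-field pressure leakage) and `C` does not bound `typeIBound`. -/
theorem stub_finiteWindowStability :
    ∀ C s : ℝ, 0 < s → ∃ δ₂ c₀ : ℝ, 0 < δ₂ ∧ 0 ≤ c₀ ∧
      ∀ (u : ℝ → ℝ³ → ℝ³) (p : ℝ → ℝ³ → ℝ) (G : ℝ → ℝ³ → ℝ³ →L[ℝ] ℝ³),
        IsSuitableWeakSolutionOn (slab ℝ³ (Set.Iio 0) isOpen_Iio) 1 0 u p →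
        HasWeakSpatialGradientOn (slab ℝ³ (Set.Iio 0) isOpen_Iio) u G →
        typeIBound (Set.Iio (0 : ℝ) ×ˢ Set.univ) u p G < ⊤ → HasTypeITimeDecay C u →
        IsClassicalNSSolutionOn (Set.Iio 0) 1 0 u p →
      ∀ (w : ℝ → ℝ³ → ℝ³) (q : ℝ → ℝ³ → ℝ) (H : ℝ → ℝ³ → ℝ³ →L[ℝ] ℝ³),
        IsSuitableWeakSolutionOn (slab ℝ³ (Set.Iio 0) isOpen_Iio) 1 0 w q →
        HasWeakSpatialGradientOn (slab ℝ³ (Set.Iio 0) isOpen_Iio) w H →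
        typeIBound (Set.Iio (0 : ℝ) ×ˢ Set.univ) w q H < ⊤ → HasTypeITimeDecay C w →
        IsClassicalNSSolutionOn (Set.Iio 0) 1 0 w q →
      ∀ δ : ℝ, 0 < δ → δ ≤ δ₂ →
      ∀ (σ₀ l₀ : ℝ) (R₀ : ℝ³ ≃ₗᵢ[ℝ] ℝ³) (ξ₀ : ℝ³) (τ₀ : ℝ), 0 < l₀ → τ₀ ≤ 0 →
        gap u w σ₀ l₀ R₀ ξ₀ τ₀ ≤ ENNReal.ofReal δ →
        ∀ σ : ℝ, σ ≤ σ₀ → σ₀ - s ≤ σ → gap u w σ l₀ R₀ ξ₀ τ₀ ≤ ENNReal.ofReal (c₀ * δ) := by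
  sorry

/-- **stub 2 — `stub_windowContraction` (XL; OPEN — the contraction certificate proper, phase-free and
finite-time).** For every rate `C` there are `δ₁ > 0` and ONE window length `s > 0` such that for all smooth
`𝒦_C` profiles `u, w`, every `0 < δ ≤ δ₁`, every `σ₀` and every `g₀ = (l₀ > 0, R₀, ξ₀, τ₀ ≤ 0)`:
`gap_{σ₀}(g₀) ≤ δ ⇒ gap_{σ₀ − s}(g₁) ≤ δ/e` for SOME `g₁ = (l > 0, R, ξ, τ ≤ 0)` (the similarity modes and
the flow direction are absorbed into `g₁`; the transversal rest contracts by a fixed factor over one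
window, with linear gain). The integrated, derivative-free output of a matrix Dulac function / Lozinskii
bound for the second additive compound of the linearised profile operator modulo the 7 similarity modes
(Muldowney 1990; Li–Muldowney 1996; Kuznetsov–Reitmann 2021 Ch. 5) plus finite-window nonlinear
shadowing. At `u = 0`: one-slice weighted-`L²` ε-regularity with gain (Jia–Šverák 2014 Thm 3.1,
Barker–Prange 2020 Thm 2). Refuted by one saddle-type (R)DSS profile / invariant torus / chaotic tangent
flow in `𝒦_C`. -/
theorem stub_windowContraction :
    ∀ C : ℝ, ∃ δ₁ s : ℝ, 0 < δ₁ ∧ 0 < s ∧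
      ∀ (u : ℝ → ℝ³ → ℝ³) (p : ℝ → ℝ³ → ℝ) (G : ℝ → ℝ³ → ℝ³ →L[ℝ] ℝ³),
        IsSuitableWeakSolutionOn (slab ℝ³ (Set.Iio 0) isOpen_Iio) 1 0 u p →
        HasWeakSpatialGradientOn (slab ℝ³ (Set.Iio 0) isOpen_Iio) u G →
        typeIBound (Set.Iio (0 : ℝ) ×ˢ Set.univ) u p G < ⊤ → HasTypeITimeDecay C u →
        IsClassicalNSSolutionOn (Set.Iio 0) 1 0 u p →
      ∀ (w : ℝ → ℝ³ → ℝ³) (q : ℝ → ℝ³ → ℝ) (H : ℝ → ℝ³ → ℝ³ →L[ℝ] ℝ³),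
        IsSuitableWeakSolutionOn (slab ℝ³ (Set.Iio 0) isOpen_Iio) 1 0 w q →
        HasWeakSpatialGradientOn (slab ℝ³ (Set.Iio 0) isOpen_Iio) w H →
        typeIBound (Set.Iio (0 : ℝ) ×ˢ Set.univ) w q H < ⊤ → HasTypeITimeDecay C w →
        IsClassicalNSSolutionOn (Set.Iio 0) 1 0 w q →
      ∀ δ : ℝ, 0 < δ → δ ≤ δ₁ →
      ∀ (σ₀ l₀ : ℝ) (R₀ : ℝ³ ≃ₗᵢ[ℝ] ℝ³) (ξ₀ : ℝ³) (τ₀ : ℝ), 0 < l₀ → τ₀ ≤ 0 →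
        gap u w σ₀ l₀ R₀ ξ₀ τ₀ ≤ ENNReal.ofReal δ →
        ∃ (l : ℝ) (R : ℝ³ ≃ₗᵢ[ℝ] ℝ³) (ξ : ℝ³) (τ : ℝ), 0 < l ∧ τ ≤ 0 ∧
          gap u w (σ₀ - s) l R ξ τ ≤ ENNReal.ofReal (δ * Real.exp (-1)) := by
  sorry

/-- **stub 3 — `stub_asymptoticPhase` (L; OPEN here — asymptotic phase for the action of the non-compact
similarity semigroup `G⁺` on `𝒦_C`).** For every `C`, rate `η > 0` and constant `c ≥ 0` there are
`η' > 0`, `c' ≥ 0`, `δ₃ > 0` such that for all smooth `𝒦_C` profiles `u, w`, every `0 < δ ≤ δ₃` and every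
`σ₀`: if `w` is SCALE-WISE exponentially close to the orbit of `u` below `σ₀`
(`∀ σ ≤ σ₀ ∃ g_σ, gap_σ(g_σ) ≤ c e^{−η(σ₀−σ)} δ`), then ONE orbit element synchronises with it
(`∃ g ∀ σ ≤ σ₀, gap_σ(g) ≤ c' e^{−η'(σ₀−σ)} δ`; a rate loss `η' ≤ η` is allowed). Summability of the phase
increments (Li–Muldowney 1995 / Smith 1986 autonomous convergence; Hale, ODEs, Ch. VI Thm 2.1), here for
a non-compact group whose orbits accumulate at `0` in `E` (`τ → −∞`). -/
theorem stub_asymptoticPhase :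
    ∀ C η c : ℝ, 0 < η → 0 ≤ c → ∃ η' c' δ₃ : ℝ, 0 < η' ∧ 0 ≤ c' ∧ 0 < δ₃ ∧
      ∀ (u : ℝ → ℝ³ → ℝ³) (p : ℝ → ℝ³ → ℝ) (G : ℝ → ℝ³ → ℝ³ →L[ℝ] ℝ³),
        IsSuitableWeakSolutionOn (slab ℝ³ (Set.Iio 0) isOpen_Iio) 1 0 u p →
        HasWeakSpatialGradientOn (slab ℝ³ (Set.Iio 0) isOpen_Iio) u G →
        typeIBound (Set.Iio (0 : ℝ) ×ˢ Set.univ) u p G < ⊤ → HasTypeITimeDecay C u →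
        IsClassicalNSSolutionOn (Set.Iio 0) 1 0 u p →
      ∀ (w : ℝ → ℝ³ → ℝ³) (q : ℝ → ℝ³ → ℝ) (H : ℝ → ℝ³ → ℝ³ →L[ℝ] ℝ³),
        IsSuitableWeakSolutionOn (slab ℝ³ (Set.Iio 0) isOpen_Iio) 1 0 w q →
        HasWeakSpatialGradientOn (slab ℝ³ (Set.Iio 0) isOpen_Iio) w H →
        typeIBound (Set.Iio (0 : ℝ) ×ˢ Set.univ) w q H < ⊤ → HasTypeITimeDecay C w →
        IsClassicalNSSolutionOn (Set.Iio 0) 1 0 w q →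
      ∀ δ : ℝ, 0 < δ → δ ≤ δ₃ → ∀ σ₀ : ℝ,
        (∀ σ : ℝ, σ ≤ σ₀ → ∃ (l : ℝ) (R : ℝ³ ≃ₗᵢ[ℝ] ℝ³) (ξ : ℝ³) (τ : ℝ), 0 < l ∧ τ ≤ 0 ∧
            gap u w σ l R ξ τ ≤ ENNReal.ofReal (c * Real.exp (-(η * (σ₀ - σ))) * δ)) →
        ∃ (l : ℝ) (R : ℝ³ ≃ₗᵢ[ℝ] ℝ³) (ξ : ℝ³) (τ : ℝ), 0 < l ∧ τ ≤ 0 ∧ ∀ σ : ℝ, σ ≤ σ₀ →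
            gap u w σ l R ξ τ ≤ ENNReal.ofReal (c' * Real.exp (-(η' * (σ₀ - σ))) * δ) := by
  sorry

/-- **Birth composition (the skeleton theorem).** The crux BY NAME from the three registered stubs, used by
name: `δ := min δ₁ (min δ₂ δ₃)`; iterate `stub_windowContraction` along the scales `σ₀ − k s` (induction on
`k`, thresholds `δ e^{−k} ≤ δ₁`); fill each window `[σ₀ − (k+1)s, σ₀ − ks]` with `stub_finiteWindowStability`
(`k = ⌊(σ₀ − σ)/s⌋₊`) and convert `c₀ δ e^{−k} ≤ (c₀ e) e^{−(σ₀−σ)/s} δ` — scale-wise exponential closeness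
to the orbit at rate `1/s`; `stub_asymptoticPhase` selects the single orbit element K1 asks for. -/
theorem SynchronizationModSimilarity_of : Theses.DulacContraction.SynchronizationModSimilarity := by
  have hS := stub_finiteWindowStability
  have hW := stub_windowContraction
  have hP := stub_asymptoticPhase
  rw [sync_iff]
  intro C
  obtain ⟨δ₁, s, hδ₁, hs, hW⟩ := hW C
  obtain ⟨δ₂, c₀, hδ₂, hc₀, hS⟩ := hS C s hs
  obtain ⟨η', c', δ₃, hη', hc', hδ₃, hP⟩ :=
    hP C s⁻¹ (c₀ * Real.exp 1) (inv_pos.2 hs) (mul_nonneg hc₀ (Real.exp_pos 1).le)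
  obtain ⟨δ, hδpos, hδ1, hδ2, hδ3⟩ : ∃ δ : ℝ, 0 < δ ∧ δ ≤ δ₁ ∧ δ ≤ δ₂ ∧ δ ≤ δ₃ :=
    ⟨min δ₁ (min δ₂ δ₃), lt_min hδ₁ (lt_min hδ₂ hδ₃), min_le_left _ _,
      (min_le_right _ _).trans (min_le_left _ _), (min_le_right _ _).trans (min_le_right _ _)⟩
  refine ⟨η', c', δ, hη', hc', hδpos, ?_⟩
  intro u p G hsu hgu hIu hdu hcu w q H hsw hgw hIw hdw hcw σ₀ l₀ R₀ ξ₀ τ₀ hl₀ hτ₀ h0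
  -- the pair is fixed from now on
  have hW := hW u p G hsu hgu hIu hdu hcu w q H hsw hgw hIw hdw hcw
  have hS := hS u p G hsu hgu hIu hdu hcu w q H hsw hgw hIw hdw hcw
  have hP := hP u p G hsu hgu hIu hdu hcu w q H hsw hgw hIw hdw hcw
  -- thresholds δ e^{-k} stay admissible
  have hthr : ∀ k : ℕ, 0 < δ * Real.exp (-(k : ℝ)) ∧ δ * Real.exp (-(k : ℝ)) ≤ δ := by
    intro k
    refine ⟨mul_pos hδpos (Real.exp_pos _), ?_⟩
    have hle : Real.exp (-(k : ℝ)) ≤ 1 :=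
      Real.exp_le_one_iff.2 (neg_nonpos.2 (Nat.cast_nonneg k))
    calc δ * Real.exp (-(k : ℝ)) ≤ δ * 1 := mul_le_mul_of_nonneg_left hle hδpos.le
      _ = δ := mul_one δ
  -- (1) iterate the one-window contraction: closeness δ e^{-k} at scale σ₀ - k s, modulo G⁺
  have key : ∀ k : ℕ, ∃ (l : ℝ) (R : ℝ³ ≃ₗᵢ[ℝ] ℝ³) (ξ : ℝ³) (τ : ℝ), 0 < l ∧ τ ≤ 0 ∧
      gap u w (σ₀ - k * s) l R ξ τ ≤ ENNReal.ofReal (δ * Real.exp (-(k : ℝ))) := by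
    intro k
    induction k with
    | zero =>
      refine ⟨l₀, R₀, ξ₀, τ₀, hl₀, hτ₀, ?_⟩
      simpa using h0
    | succ k ih =>
      obtain ⟨l, R, ξ, τ, hl, hτ, hk⟩ := ih
      obtain ⟨l', R', ξ', τ', hl', hτ', hk'⟩ :=
        hW _ (hthr k).1 ((hthr k).2.trans hδ1) (σ₀ - k * s) l R ξ τ hl hτ hk
      refine ⟨l', R', ξ', τ', hl', hτ', ?_⟩
      have e1 : σ₀ - (k : ℝ) * s - s = σ₀ - ((k + 1 : ℕ) : ℝ) * s := by
        push_cast; ring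
      have e2 : δ * Real.exp (-(k : ℝ)) * Real.exp (-1) = δ * Real.exp (-((k + 1 : ℕ) : ℝ)) := by
        rw [mul_assoc, ← Real.exp_add]
        congr 1; congr 1
        push_cast; ring
      rw [e1, e2] at hk'
      exact hk'
  -- (2) fill the windows: scale-wise exponential closeness to the orbit at rate 1/s
  have horbit : ∀ σ : ℝ, σ ≤ σ₀ → ∃ (l : ℝ) (R : ℝ³ ≃ₗᵢ[ℝ] ℝ³) (ξ : ℝ³) (τ : ℝ), 0 < l ∧ τ ≤ 0 ∧
      gap u w σ l R ξ τ ≤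
        ENNReal.ofReal (c₀ * Real.exp 1 * Real.exp (-(s⁻¹ * (σ₀ - σ))) * δ) := by
    intro σ hσ
    obtain ⟨k, hk1, hk2⟩ : ∃ k : ℕ, (k : ℝ) * s ≤ σ₀ - σ ∧ σ₀ - σ < k * s + s := by
      have hnn : 0 ≤ (σ₀ - σ) / s := div_nonneg (sub_nonneg.2 hσ) hs.le
      refine ⟨⌊(σ₀ - σ) / s⌋₊, ?_, ?_⟩
      · calc (⌊(σ₀ - σ) / s⌋₊ : ℝ) * s ≤ (σ₀ - σ) / s * s :=
            mul_le_mul_of_nonneg_right (Nat.floor_le hnn) hs.le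
          _ = σ₀ - σ := div_mul_cancel₀ _ hs.ne'
      · calc σ₀ - σ = (σ₀ - σ) / s * s := (div_mul_cancel₀ _ hs.ne').symm
          _ < ((⌊(σ₀ - σ) / s⌋₊ : ℝ) + 1) * s :=
            mul_lt_mul_of_pos_right (Nat.lt_floor_add_one _) hs
          _ = (⌊(σ₀ - σ) / s⌋₊ : ℝ) * s + s := by ring
    obtain ⟨l, R, ξ, τ, hl, hτ, hk⟩ := key k
    have hwin :=
      hS _ (hthr k).1 ((hthr k).2.trans hδ2) (σ₀ - k * s) l R ξ τ hl hτ hk σ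
        (by linarith) (by linarith)
    refine ⟨l, R, ξ, τ, hl, hτ, hwin.trans (ENNReal.ofReal_le_ofReal ?_)⟩
    have hlt : s⁻¹ * (σ₀ - σ) < k + 1 := by
      calc s⁻¹ * (σ₀ - σ) < s⁻¹ * (k * s + s) := mul_lt_mul_of_pos_left hk2 (inv_pos.2 hs)
        _ = k + 1 := by field_simp
    have hexp : Real.exp (-(k : ℝ)) ≤ Real.exp 1 * Real.exp (-(s⁻¹ * (σ₀ - σ))) := by
      rw [← Real.exp_add]
      exact Real.exp_le_exp.2 (by linarith)
    calc c₀ * (δ * Real.exp (-(k : ℝ))) = c₀ * Real.exp (-(k : ℝ)) * δ := by ring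
      _ ≤ c₀ * (Real.exp 1 * Real.exp (-(s⁻¹ * (σ₀ - σ)))) * δ :=
        mul_le_mul_of_nonneg_right (mul_le_mul_of_nonneg_left hexp hc₀) hδpos.le
      _ = c₀ * Real.exp 1 * Real.exp (-(s⁻¹ * (σ₀ - σ))) * δ := by ring
  -- (3) asymptotic phase: one orbit element
  exact hP δ hδpos hδ3 σ₀ horbit

end Summit.NavierStokesRegularity.NavierStokesRegularity.Cruxes.SynchronizationModSimilarity.Birth
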